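import Summits.ResolutionOfSingularities.ResolutionOfSingularities.Theorems.SandwichedSingularitiesResolution
import Literature.AlgebraicGeometry.Resolution.ResolutionOfComponents
import Literature.AlgebraicGeometry.Resolution.BlowupsProperProofs
import Literature.AlgebraicGeometry.Resolution.BlowupsIntegral
import Mathlib.AlgebraicGeometry.Noetherian
import HarnessLib

/-!
# Crux `PatchingRel` (stmt-ResolutionOfSingularities-0642), line `sandwiched-gluing` (v3 cut),
# stub `stub_resolutionInChar_of_blowupResolutionInChar`

**Resolution by one blowing up implies resolution** (`BlowupResolutionInChar p ⇒
ResolutionInChar p`). The v3 cut of the line `sandwiched-gluing` works with the format statement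
`BlowupResolutionInChar p` ("every integral separated scheme of finite type over a field of
characteristic `p` carries a non-zero ideal sheaf whose blowing up is regular"), the form in which
resolution theorems are actually proved (Hironaka 1964, Cossart–Jannsen–Saito 2020,
Cossart–Piltant: composites of blowing ups, and a composite of blowing ups of a variety is one
blowing up). This file records that it is at least as strong as the weak summit slice
`Literature.AlgebraicGeometry.Resolution.ResolutionInChar p`:

* `hasResolution_of_isBlowup_of_isRegular` — a blowing up `π : X' → X` of an integral locally
  Noetherian scheme `X` along a non-zero ideal sheaf is proper (blowing ups of locally Noetherian
  schemes are projective, Görtz–Wedhorn I, Prop. 13.96 (1); `IsBlowup.isProper`) and birational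
  with integral source (Stacks 02ND; `IsBlowup.isBirational'`, `IsBlowup.isIntegral`), so if `X'`
  is regular it is a resolution of singularities of `X` (`Scheme.HasResolution X`);
* `resolutionInChar_of_blowupResolutionInChar` — hence `BlowupResolutionInChar p` gives the
  integral case `IntegralResolutionInChar p` (a scheme locally of finite type over a field is
  locally Noetherian), and the reduced case is equivalent to the integral one
  (`resolutionInChar_iff_integral`: resolve the irreducible components and glue,
  Cossart–Piltant 2019, proof of Prop. 4.6, Step 1);
* `stub_resolutionInChar_of_blowupResolutionInChar` — the registered universe-`0` stub B7.

## References

* U. Görtz, T. Wedhorn, *Algebraic Geometry I*, 2nd ed. (2020), Prop. 13.96 (1) (blowing ups of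
  locally Noetherian schemes are projective). [GortzWedhorn2020]
* The Stacks Project, Tag 02ND (a blowing up of an integral scheme along a non-zero ideal is
  integral and birational), Tag 02NS. [StacksProject]
* V. Cossart, O. Piltant, *Resolution of singularities of arithmetical threefolds*, J. Algebra
  529 (2019) 268–535, proof of Prop. 4.6, Step 1 (reduction to the integral case).
  [CossartPiltant2019]
-/

-- `Summit.<Summit>.<Sub>.Theorems` with `Sub = Summit` (single-conjunct summit, D-0017): the
-- duplicated namespace component is the tree layout.
set_option linter.dupNamespace false

noncomputable section

namespace Summit.ResolutionOfSingularities.ResolutionOfSingularities.Theorems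

open CategoryTheory AlgebraicGeometry
open Literature.AlgebraicGeometry.Resolution
open Summit.ResolutionOfSingularities.ResolutionOfSingularities

universe u

/-- **A regular blowing up of an integral locally Noetherian scheme along a non-zero ideal sheaf
is a resolution of singularities.** If `X` is integral and locally Noetherian, `I ≠ 0` is a
(quasi-coherent) ideal sheaf on `X`, `π : X' → X` is a blowing up of `X` along `I` and `X'` is
regular, then `X` admits a resolution: `π` is proper (`IsBlowup.isProper`, Görtz–Wedhorn I,
Prop. 13.96 (1)) and birational (`IsBlowup.isBirational'`, Stacks 02ND). [folklore] -/
theorem hasResolution_of_isBlowup_of_isRegular {X X' : Scheme.{u}} [IsIntegral X]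
    [IsLocallyNoetherian X] {I : X.IdealSheafData} {π : X' ⟶ X} (hI : I ≠ ⊥)
    (hπ : IsBlowup π I) (hreg : Scheme.IsRegular X') : Scheme.HasResolution X :=
  ⟨X', π, ⟨hπ.isProper, hπ.isBirational' hI, hreg⟩⟩

/-- **Resolution by one blowing up implies resolution in characteristic `p`**:
`BlowupResolutionInChar p → ResolutionInChar p`. By `resolutionInChar_iff_integral` it suffices
to resolve integral separated `k`-schemes of finite type `X`; such an `X` is locally Noetherian
(`LocallyOfFiniteType.isLocallyNoetherian`), and the regular blowing up along a non-zero ideal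
sheaf provided by the hypothesis is a resolution (`hasResolution_of_isBlowup_of_isRegular`).
[folklore] -/
theorem resolutionInChar_of_blowupResolutionInChar {p : ℕ} (h : BlowupResolutionInChar.{u} p) :
    ResolutionInChar.{u} p := by
  rw [resolutionInChar_iff_integral]
  intro k _ _ X g hsep hft hqc hint
  haveI := hft
  haveI : IsLocallyNoetherian X := LocallyOfFiniteType.isLocallyNoetherian g
  obtain ⟨I, X', π, hI, hπ, hreg⟩ := h k X g hsep hft hqc hint
  exact hasResolution_of_isBlowup_of_isRegular hI hπ hreg

/-- **Registered stub B7 of line `sandwiched-gluing` (v3 cut)** (crux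
stmt-ResolutionOfSingularities-0642, universe `0`): `BlowupResolutionInChar p ⇒ ResolutionInChar p`
— a blowing up of an integral locally Noetherian scheme along a non-zero ideal sheaf is proper and
birational, so a regular one is a resolution; the reduced case follows from the integral one
(`resolutionInChar_iff_integral`). [folklore] -/
theorem stub_resolutionInChar_of_blowupResolutionInChar :
    ∀ p : ℕ, BlowupResolutionInChar.{0} p → ResolutionInChar.{0} p :=
  fun _ h => resolutionInChar_of_blowupResolutionInChar h

end Summit.ResolutionOfSingularities.ResolutionOfSingularities.Theorems

end
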